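import Mathlib.Analysis.MellinTransform
import Mathlib.NumberTheory.LSeries.RiemannZeta
import Mathlib.Analysis.Complex.Convex
import Mathlib.Analysis.Analytic.Uniqueness
import Mathlib.Analysis.Complex.CauchyIntegral
import Mathlib.Analysis.Calculus.MeanValue
import Literature.NumberTheory.LFunctions.MuentzFormula
import HarnessLib

/-!
# Müntz's formula in the critical strip (the case `∫ F = 0`), and Connes' `𝓔` across the critical line

Topic `Literature/NumberTheory/LFunctions` (sequel of `MuentzFormula.lean`, which treats `Re s > 1`).
Everything in this file is PROVED; there are no named facts.

Müntz's formula (Titchmarsh, *The Theory of the Riemann Zeta-Function*, §2.11, (2.11.1)): for good `F`,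
`ζ(s) ∫_0^∞ F(x) x^{s-1} dx = ∫_0^∞ (Σ_{n ≥ 1} F(n x) − x^{-1} ∫_0^∞ F) x^{s-1} dx` on `0 < σ < 1`, obtained
from the absolutely convergent case `σ > 1` by analytic continuation.  We formalise the case `∫ F = 0`, which
is the one used by Riemann/Connes (`∫ h = 0`, `∫ h_λ = 0`): then no polar term appears, the summatory function
`G(x) = Σ_{n ≥ 1} F(n x)` stays bounded as `x → 0⁺`, and the identity `𝓜G(s) = ζ(s) 𝓜F(s)` holds on the whole
region `0 < Re s`, `s ≠ 1` (both sides being holomorphic there).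

* `norm_mul_tsum_indicator_comp_mul_nat_sub_integral_le` — the Riemann-sum estimate
  `‖x Σ_{n ≥ 1} F(n x) − ∫_0^A F₀‖ ≤ (L A + M) x` for `F = 1_{(0,A]} F₀`, `F₀` `L`-Lipschitz and bounded by
  `M` on `[0, A]`; hence (`norm_tsum_indicator_comp_mul_nat_le`) `Σ_{n ≥ 1} F(n x)` is bounded when
  `∫_0^A F₀ = 0` (Titchmarsh's "`x^{-1} ∫ F + O(1)`" step, for Lipschitz data with a jump at `A`).
* `locallyIntegrableOn_tsum_comp_mul_nat` — `G` is locally integrable on `(0, ∞)` as soon as `F` has an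
  absolutely convergent Mellin transform somewhere in `Re s > 1`.
* `mellin_tsum_comp_mul_nat_of_isBigO` — **the analytic continuation step, abstractly**: if `F` and `G`
  are locally integrable on `(0,∞)`, `O(x^{-a})` at `∞` (`a > 1`) and `O(x^{-b})` at `0`, then
  `𝓜G(s) = ζ(s) 𝓜F(s)` for all `s ≠ 1` with `b < Re s < a` (identity theorem on convex pieces of the strip,
  from the agreement on `Re s > 1` proved in `MuentzFormula.lean`; Mathlib supplies holomorphy of Mellin
  transforms, `mellin_differentiableAt_of_isBigO_rpow`, and of `ζ` away from `1`).
* `mellin_tsum_indicator_comp_mul_nat` — **Müntz (2.11.1) with `c = ∫F = 0`** for compactly supported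
  Lipschitz data: `𝓜G(s) = ζ(s) 𝓜F(s)` and absolute convergence of `𝓜G(s)`, for all `Re s > 0`, `s ≠ 1`.
* `mellin_connesE_of_integral_eq_zero` — **Connes' `𝓔` across the critical line**: for `f` Lipschitz on
  `[0, A]`, zero on `(A, ∞)`, `∫_0^A f = 0`: `∫_0^∞ 𝓔(f)(u) u^{s-1} du = ζ(½ + s) ∫_0^∞ f(x) x^{s-1/2} dx` for
  `Re s > −½`, `s ≠ ½` — in particular on the open critical strip `|Re s| < ½` minus the pole of `ζ(½ + s)`
  (Connes 2026, Letter §6.2/§6.4; Connes–Consani–Moscovici 2025, (7.1) and the proof of Lemma 7.3).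
* `mellin_connesE_prolateGuessH` — the same for the prolate guess `h_λ = prolateGuessH λ h_{0,λ} h_{4,λ}` of
  `ConnesProlateGuess.lean`, under the hypothesis `∫_0^λ h_λ = 0` (prolate functions are `C²` on `[−λ, λ]`,
  hence Lipschitz: `exists_lipschitzOnWith_of_contDiffOn_Icc`).

Not formalised here: the general case `∫ F ≠ 0` of (2.11.1) (polar term `x^{-1} ∫ F`, strip `0 < σ < 1`
only), and the Schwartz-class version needed for `h` itself (Hermite functions); Fact 6.4 (the `λ → ∞`
limit) is untouched — this file supplies only the exact identity ("Lemma M") that its proof starts from.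

## References

* E. C. Titchmarsh, *The Theory of the Riemann Zeta-Function*, 2nd ed. (rev. D. R. Heath-Brown), Oxford 1986,
  §2.11, formula (2.11.1) [Titchmarsh1986].
* A. Connes, *The Riemann Hypothesis: Past, Present and a Letter Through Time*, arXiv:2602.04022 (2026),
  §6.2 (Fact 6.2), §6.4 [Connes2026Letter].
* A. Connes, C. Consani, H. Moscovici, *Zeta Spectral Triples*, arXiv:2511.22755 (2025), §7, (7.1)–(7.4),
  Lemma 7.3 [ConnesConsaniMoscovici2025].
-/

noncomputable section

open Real Complex Set MeasureTheory Filter Topology Asymptotics intervalIntegral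
open scoped NNReal

namespace Literature.NumberTheory.LFunctions

/-! ### A Riemann-sum estimate: `x Σ_{n ≥ 1} F(n x)` versus `∫ F` -/

/-- **Riemann-sum estimate.**  If `F₀` is `L`-Lipschitz on `[0, A]` and `F = 1_{(0,A]} F₀`, then for every
`x > 0`, `‖x Σ_{n ≥ 1} F(n x) − ∫_0^A F₀‖ ≤ (L A + M) x`, where `M` bounds `‖F₀‖` on `[0, A]`
(the sum is the finite sum over `n ≤ A/x`; each term is compared with `∫_{(n-1)x}^{nx} F₀`). [folklore] -/
theorem norm_mul_tsum_indicator_comp_mul_nat_sub_integral_le {F₀ : ℝ → ℂ} {A M : ℝ} {L : ℝ≥0}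
    (hA : 0 < A) (hLip : LipschitzOnWith L F₀ (Icc 0 A)) (hM : ∀ t ∈ Icc 0 A, ‖F₀ t‖ ≤ M)
    {x : ℝ} (hx : 0 < x) :
    ‖(x : ℂ) * ∑' n : ℕ, (Ioc 0 A).indicator F₀ (((n + 1 : ℕ) : ℝ) * x) - ∫ t in (0 : ℝ)..A, F₀ t‖
      ≤ (L * A + M) * x := by
  have hcont : ContinuousOn F₀ (Icc 0 A) := hLip.continuousOn
  have hM0 : 0 ≤ M := (norm_nonneg _).trans (hM 0 ⟨le_rfl, hA.le⟩)
  set N : ℕ := ⌊A / x⌋₊ with hN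
  have hNx : (N : ℝ) * x ≤ A := by
    have : (N : ℝ) ≤ A / x := Nat.floor_le (div_nonneg hA.le hx.le)
    rwa [le_div_iff₀ hx] at this
  have hAN : A < (N + 1 : ℝ) * x := by
    have : A / x < (N : ℝ) + 1 := Nat.lt_floor_add_one _
    rwa [div_lt_iff₀ hx] at this
  -- the sum is finite
  have hsum : ∑' n : ℕ, (Ioc 0 A).indicator F₀ (((n + 1 : ℕ) : ℝ) * x)
      = ∑ n ∈ Finset.range N, F₀ (((n + 1 : ℕ) : ℝ) * x) := by
    rw [tsum_eq_sum (s := Finset.range N)]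
    · refine Finset.sum_congr rfl fun n hn ↦ ?_
      rw [Finset.mem_range] at hn
      have hmem : (((n + 1 : ℕ) : ℝ)) * x ∈ Ioc 0 A :=
        ⟨by positivity, calc (((n + 1 : ℕ) : ℝ)) * x ≤ (N : ℝ) * x := by gcongr; exact_mod_cast hn
          _ ≤ A := hNx⟩
      exact Set.indicator_of_mem hmem F₀
    · intro n hn
      rw [Finset.mem_range, not_lt] at hn
      refine Set.indicator_of_notMem (fun h ↦ ?_) _
      have h2 : (((n + 1 : ℕ) : ℝ)) * x ≤ A := h.2
      have hNn : (N : ℝ) ≤ n := by exact_mod_cast hn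
      push_cast at h2
      nlinarith [mul_le_mul_of_nonneg_right hNn hx.le]
  -- interval integrability on subintervals of `[0, A]`
  have hII : ∀ a b : ℝ, 0 ≤ a → a ≤ b → b ≤ A → IntervalIntegrable F₀ volume a b := by
    intro a b ha hab hb
    refine (hcont.mono ?_).intervalIntegrable
    rw [uIcc_of_le hab]
    exact Icc_subset_Icc ha hb
  -- split the integral at `N x`
  have hsplit : ∫ t in (0 : ℝ)..A, F₀ t
      = (∑ n ∈ Finset.range N, ∫ t in ((n : ℝ) * x)..(((n + 1 : ℕ) : ℝ) * x), F₀ t)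
        + ∫ t in ((N : ℝ) * x)..A, F₀ t := by
    have h1 : ∑ n ∈ Finset.range N, ∫ t in ((n : ℝ) * x)..(((n + 1 : ℕ) : ℝ) * x), F₀ t
        = ∫ t in ((0 : ℕ) : ℝ) * x..(N : ℝ) * x, F₀ t := by
      refine sum_integral_adjacent_intervals (a := fun k : ℕ ↦ (k : ℝ) * x) fun k hk ↦ ?_
      refine hII _ _ (by positivity) ?_ ?_
      · gcongr; exact_mod_cast (Nat.le_succ k)
      · calc (((k + 1 : ℕ) : ℝ)) * x ≤ (N : ℝ) * x := by gcongr; exact_mod_cast hk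
          _ ≤ A := hNx
    rw [h1, Nat.cast_zero, zero_mul]
    exact (integral_add_adjacent_intervals (hII _ _ le_rfl (by positivity) hNx)
      (hII _ _ (by positivity) hNx le_rfl)).symm
  -- termwise estimate
  have hterm : ∀ n ∈ Finset.range N,
      ‖(x : ℂ) * F₀ (((n + 1 : ℕ) : ℝ) * x) - ∫ t in ((n : ℝ) * x)..(((n + 1 : ℕ) : ℝ) * x), F₀ t‖
        ≤ L * x * x := by
    intro n hn
    rw [Finset.mem_range] at hn
    have hn1 : (((n + 1 : ℕ) : ℝ)) * x ≤ A :=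
      calc (((n + 1 : ℕ) : ℝ)) * x ≤ (N : ℝ) * x := by gcongr; exact_mod_cast hn
        _ ≤ A := hNx
    have hlen : (((n + 1 : ℕ) : ℝ)) * x - (n : ℝ) * x = x := by push_cast; ring
    have hle : (n : ℝ) * x ≤ (((n + 1 : ℕ) : ℝ)) * x := by linarith
    have hIIn : IntervalIntegrable F₀ volume ((n : ℝ) * x) (((n + 1 : ℕ) : ℝ) * x) :=
      hII _ _ (by positivity) hle hn1
    have hrw : (x : ℂ) * F₀ (((n + 1 : ℕ) : ℝ) * x)
        - ∫ t in ((n : ℝ) * x)..(((n + 1 : ℕ) : ℝ) * x), F₀ t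
        = ∫ t in ((n : ℝ) * x)..(((n + 1 : ℕ) : ℝ) * x), (F₀ (((n + 1 : ℕ) : ℝ) * x) - F₀ t) := by
      rw [intervalIntegral.integral_sub intervalIntegrable_const hIIn, intervalIntegral.integral_const,
        hlen, Complex.real_smul]
    rw [hrw]
    have hb := intervalIntegral.norm_integral_le_of_norm_le_const (a := (n : ℝ) * x)
      (b := (((n + 1 : ℕ) : ℝ)) * x) (C := L * x) (f := fun t ↦ F₀ (((n + 1 : ℕ) : ℝ) * x) - F₀ t) ?_
    · have hlen' : ((n : ℝ) + 1) * x - n * x = x := by ring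
      simpa [hlen', abs_of_pos hx] using hb
    intro t ht
    rw [uIoc_of_le hle] at ht
    have ht0 : 0 ≤ t := le_trans (by positivity) ht.1.le
    have h := hLip.dist_le_mul _ ⟨by positivity, hn1⟩ t ⟨ht0, ht.2.trans hn1⟩
    rw [dist_eq_norm, Real.dist_eq, abs_of_nonneg (by linarith [ht.2])] at h
    refine h.trans ?_
    gcongr
    linarith [ht.1]
  -- tail estimate
  have htail : ‖∫ t in ((N : ℝ) * x)..A, F₀ t‖ ≤ M * x := by
    have hb := intervalIntegral.norm_integral_le_of_norm_le_const (a := (N : ℝ) * x) (b := A) (C := M)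
      (f := F₀) fun t ht ↦ ?_
    · refine hb.trans ?_
      rw [abs_of_nonneg (by linarith)]
      gcongr
      linarith
    · rw [uIoc_of_le hNx] at ht
      exact hM t ⟨le_trans (by positivity) ht.1.le, ht.2⟩
  -- assemble
  rw [hsum, hsplit, Finset.mul_sum, ← sub_sub, ← Finset.sum_sub_distrib]
  calc ‖(∑ n ∈ Finset.range N, ((x : ℂ) * F₀ (((n + 1 : ℕ) : ℝ) * x)
          - ∫ t in ((n : ℝ) * x)..(((n + 1 : ℕ) : ℝ) * x), F₀ t)) - ∫ t in ((N : ℝ) * x)..A, F₀ t‖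
      ≤ ‖∑ n ∈ Finset.range N, ((x : ℂ) * F₀ (((n + 1 : ℕ) : ℝ) * x)
          - ∫ t in ((n : ℝ) * x)..(((n + 1 : ℕ) : ℝ) * x), F₀ t)‖ + ‖∫ t in ((N : ℝ) * x)..A, F₀ t‖ :=
        norm_sub_le _ _
    _ ≤ (∑ n ∈ Finset.range N, L * x * x) + M * x := by
        gcongr
        exact (norm_sum_le _ _).trans (Finset.sum_le_sum hterm)
    _ = (N : ℝ) * x * (L * x) + M * x := by
        rw [Finset.sum_const, Finset.card_range, nsmul_eq_mul]; ring
    _ ≤ A * (L * x) + M * x := by gcongr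
    _ = (L * A + M) * x := by ring

/-- With `∫_0^A F₀ = 0`, the sums `Σ_{n ≥ 1} F(n x)` (`F = 1_{(0,A]} F₀`) stay bounded as `x → 0⁺`:
`‖Σ_{n ≥ 1} F(n x)‖ ≤ L A + M` for all `x > 0`. [folklore] -/
theorem norm_tsum_indicator_comp_mul_nat_le {F₀ : ℝ → ℂ} {A M : ℝ} {L : ℝ≥0}
    (hA : 0 < A) (hLip : LipschitzOnWith L F₀ (Icc 0 A)) (hM : ∀ t ∈ Icc 0 A, ‖F₀ t‖ ≤ M)
    (hint : ∫ t in (0 : ℝ)..A, F₀ t = 0) {x : ℝ} (hx : 0 < x) :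
    ‖∑' n : ℕ, (Ioc 0 A).indicator F₀ (((n + 1 : ℕ) : ℝ) * x)‖ ≤ L * A + M := by
  have h := norm_mul_tsum_indicator_comp_mul_nat_sub_integral_le hA hLip hM hx
  rw [hint, sub_zero, norm_mul, Complex.norm_real, Real.norm_eq_abs, abs_of_pos hx] at h
  exact le_of_mul_le_mul_left (by linarith) hx

/-! ### Local integrability of `x ↦ Σ_{n ≥ 1} F(n x)` -/

/-- If `F` has an absolutely convergent Mellin transform at some `s` with `Re s > 1`, then
`x ↦ Σ_{n ≥ 1} F(n x)` is locally integrable on `(0, ∞)` (indeed `x^{s-1} Σ_n F(n x)` is integrable there,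
by `mellin_tsum_comp_mul_nat`). [folklore] -/
theorem locallyIntegrableOn_tsum_comp_mul_nat (F : ℝ → ℂ) {s : ℂ} (hs : 1 < s.re)
    (hF : MellinConvergent F s) :
    LocallyIntegrableOn (fun x ↦ ∑' n : ℕ, F (((n + 1 : ℕ) : ℝ) * x)) (Ioi 0) := by
  have h := (mellin_tsum_comp_mul_nat F hs hF).1
  rw [MellinConvergent] at h
  rw [locallyIntegrableOn_iff isOpen_Ioi.isLocallyClosed]
  intro K hK hKc
  have hcont : ContinuousOn (fun x : ℝ ↦ (x : ℂ) ^ (1 - s)) K :=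
    continuousOn_of_forall_continuousAt fun t ht ↦
      continuousAt_ofReal_cpow_const _ _ (Or.inr (ne_of_gt (hK ht)))
  refine ((h.mono_set hK).continuousOn_smul hcont hKc).congr_fun (fun x hx ↦ ?_) hKc.measurableSet
  have hx : (x : ℂ) ≠ 0 := ofReal_ne_zero.mpr (ne_of_gt (hK hx))
  simp only [smul_eq_mul, ← mul_assoc, ← cpow_add _ _ hx, sub_add_sub_cancel, sub_self, cpow_zero,
    one_mul]

/-! ### Müntz's formula in the strip: analytic continuation -/

/-- **Müntz's formula by analytic continuation (abstract form).**  Let `F : (0,∞) → ℂ` be locally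
integrable, `O(x^{-a})` at `∞` with `a > 1` and `O(x^{-b})` at `0`, and suppose `G(x) = Σ_{n ≥ 1} F(n x)` is
also locally integrable, `O(x^{-a})` at `∞` and `O(x^{-b})` at `0`.  Then
`∫_0^∞ G(x) x^{s-1} dx = ζ(s) ∫_0^∞ F(x) x^{s-1} dx` for every `s ≠ 1` with `b < Re s < a`:
both sides are holomorphic on that strip minus `s = 1` (Mathlib: `mellin_differentiableAt_of_isBigO_rpow`,
`differentiableAt_riemannZeta`) and they agree on `Re s > 1` (`mellin_tsum_comp_mul_nat`), so they agree
by the identity theorem (applied on convex pieces of the strip).  When `∫_0^∞ F = 0` one can take `b = 0`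
(Titchmarsh §2.11, (2.11.1) with `c = 0`); in general `G(x) ~ (∫F)/x` forces `b = 1` and nothing is
gained. [cite: Titchmarsh1986, §2.11 (2.11.1)] -/
theorem mellin_tsum_comp_mul_nat_of_isBigO {F : ℝ → ℂ} {a b : ℝ} (ha : 1 < a)
    (hF_int : LocallyIntegrableOn F (Ioi 0))
    (hF_top : F =O[atTop] (· ^ (-a))) (hF_bot : F =O[𝓝[>] 0] (· ^ (-b)))
    (hG_int : LocallyIntegrableOn (fun x ↦ ∑' n : ℕ, F (((n + 1 : ℕ) : ℝ) * x)) (Ioi 0))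
    (hG_top : (fun x ↦ ∑' n : ℕ, F (((n + 1 : ℕ) : ℝ) * x)) =O[atTop] (· ^ (-a)))
    (hG_bot : (fun x ↦ ∑' n : ℕ, F (((n + 1 : ℕ) : ℝ) * x)) =O[𝓝[>] 0] (· ^ (-b)))
    {s : ℂ} (hbs : b < s.re) (hsa : s.re < a) (hs1 : s ≠ 1) :
    mellin (fun x ↦ ∑' n : ℕ, F (((n + 1 : ℕ) : ℝ) * x)) s = riemannZeta s * mellin F s := by
  set f : ℂ → ℂ := mellin (fun x ↦ ∑' n : ℕ, F (((n + 1 : ℕ) : ℝ) * x)) with hf_def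
  set g : ℂ → ℂ := fun z ↦ riemannZeta z * mellin F z with hg_def
  change f s = g s
  have hba : b < a := hbs.trans hsa
  -- the strip `b < Re z < a`
  have hf_diff : ∀ z : ℂ, b < z.re → z.re < a → DifferentiableAt ℂ f z := fun z h1 h2 ↦
    mellin_differentiableAt_of_isBigO_rpow hG_int hG_top h2 hG_bot h1
  have hg_diff : ∀ z : ℂ, b < z.re → z.re < a → z ≠ 1 → DifferentiableAt ℂ g z := fun z h1 h2 h3 ↦
    (differentiableAt_riemannZeta h3).mul
      (mellin_differentiableAt_of_isBigO_rpow hF_int hF_top h2 hF_bot h1)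
  have hbase : ∀ z : ℂ, b < z.re → z.re < a → 1 < z.re → f z = g z := fun z h1 h2 h3 ↦
    (mellin_tsum_comp_mul_nat F h3 (mellinConvergent_of_isBigO_rpow hF_int hF_top h2 hF_bot h1)).2
  -- identity theorem on a convex open piece of the strip avoiding `1`
  have key : ∀ U : Set ℂ, IsOpen U → Convex ℝ U → (∀ z ∈ U, b < z.re ∧ z.re < a ∧ z ≠ 1) →
      ∀ z₀ ∈ U, f =ᶠ[𝓝 z₀] g → EqOn f g U := by
    intro U hUo hUc hUS z₀ hz₀ hfg
    have hfU : AnalyticOnNhd ℂ f U :=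
      DifferentiableOn.analyticOnNhd
        (fun z hz ↦ (hf_diff z (hUS z hz).1 (hUS z hz).2.1).differentiableWithinAt) hUo
    have hgU : AnalyticOnNhd ℂ g U :=
      DifferentiableOn.analyticOnNhd
        (fun z hz ↦ (hg_diff z (hUS z hz).1 (hUS z hz).2.1 (hUS z hz).2.2).differentiableWithinAt) hUo
    exact hfU.eqOn_of_preconnected_of_eventuallyEq hgU hUc.isPreconnected hz₀ hfg
  -- the base region `max b 1 < Re z < a` is open and `f = g` there
  have hW_open : IsOpen {z : ℂ | max b 1 < z.re ∧ z.re < a} :=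
    (isOpen_lt continuous_const continuous_re).inter (isOpen_lt continuous_re continuous_const)
  have hW_eq : EqOn f g {z : ℂ | max b 1 < z.re ∧ z.re < a} := fun z hz ↦
    hbase z ((le_max_left _ _).trans_lt hz.1) hz.2 ((le_max_right _ _).trans_lt hz.1)
  set σ₀ : ℝ := (max b 1 + a) / 2 with hσ₀
  have hσ₀1 : max b 1 < σ₀ := by
    rw [hσ₀]; have := max_lt hba ha; linarith
  have hσ₀2 : σ₀ < a := by
    rw [hσ₀]; have := max_lt hba ha; linarith
  -- upper and lower half-strips
  have hhalf : ∀ ε : ℝ, (ε = 1 ∨ ε = -1) →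
      EqOn f g ({z : ℂ | b < z.re} ∩ {z : ℂ | z.re < a} ∩ {z : ℂ | 0 < ε * z.im}) := by
    intro ε hε
    have hUo : IsOpen ({z : ℂ | b < z.re} ∩ {z : ℂ | z.re < a} ∩ {z : ℂ | 0 < ε * z.im}) :=
      ((isOpen_lt continuous_const continuous_re).inter
        (isOpen_lt continuous_re continuous_const)).inter
        (isOpen_lt continuous_const (continuous_const.mul continuous_im))
    have hUc : Convex ℝ ({z : ℂ | b < z.re} ∩ {z : ℂ | z.re < a} ∩ {z : ℂ | 0 < ε * z.im}) := by
      refine ((convex_halfSpace_re_gt _).inter (convex_halfSpace_re_lt _)).inter ?_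
      rcases hε with h | h
      · simpa [h] using convex_halfSpace_im_gt (0 : ℝ)
      · have : {z : ℂ | 0 < ε * z.im} = {z : ℂ | z.im < 0} := by
          ext z; simp [h]
        rw [this]; exact convex_halfSpace_im_lt 0
    set z₀ : ℂ := ⟨σ₀, ε⟩ with hz₀
    have hz₀U : z₀ ∈ {z : ℂ | b < z.re} ∩ {z : ℂ | z.re < a} ∩ {z : ℂ | 0 < ε * z.im} := by
      refine ⟨⟨?_, ?_⟩, ?_⟩
      · show b < σ₀; exact (le_max_left _ _).trans_lt hσ₀1
      · show σ₀ < a; exact hσ₀2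
      · show 0 < ε * ε; rcases hε with h | h <;> simp [h]
    refine key _ hUo hUc (fun z hz ↦ ⟨hz.1.1, hz.1.2, fun h ↦ ?_⟩) z₀ hz₀U ?_
    · have := hz.2; rw [h] at this; simp at this
    · refine eventuallyEq_of_mem (hW_open.mem_nhds ⟨?_, ?_⟩) hW_eq
      · show max b 1 < σ₀; exact hσ₀1
      · show σ₀ < a; exact hσ₀2
  have hUp := hhalf 1 (Or.inl rfl)
  have hUm := hhalf (-1) (Or.inr rfl)
  -- the left piece `b < Re z < min a 1`
  have hV : EqOn f g ({z : ℂ | b < z.re} ∩ {z : ℂ | z.re < a} ∩ {z : ℂ | z.re < 1}) := by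
    intro z hz
    have hUo : IsOpen ({z : ℂ | b < z.re} ∩ {z : ℂ | z.re < a} ∩ {z : ℂ | z.re < 1}) :=
      ((isOpen_lt continuous_const continuous_re).inter
        (isOpen_lt continuous_re continuous_const)).inter (isOpen_lt continuous_re continuous_const)
    have hUc : Convex ℝ ({z : ℂ | b < z.re} ∩ {z : ℂ | z.re < a} ∩ {z : ℂ | z.re < 1}) :=
      ((convex_halfSpace_re_gt _).inter (convex_halfSpace_re_lt _)).inter (convex_halfSpace_re_lt _)
    set z₁ : ℂ := ⟨z.re, 1⟩ with hz₁
    have hz₁U : z₁ ∈ {z : ℂ | b < z.re} ∩ {z : ℂ | z.re < a} ∩ {z : ℂ | z.re < 1} :=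
      ⟨⟨hz.1.1, hz.1.2⟩, hz.2⟩
    have hz1Up : z₁ ∈ {z : ℂ | b < z.re} ∩ {z : ℂ | z.re < a} ∩ {z : ℂ | 0 < (1 : ℝ) * z.im} :=
      ⟨⟨hz.1.1, hz.1.2⟩, by show 0 < (1 : ℝ) * 1; norm_num⟩
    have hUpo : IsOpen ({z : ℂ | b < z.re} ∩ {z : ℂ | z.re < a} ∩ {z : ℂ | 0 < (1 : ℝ) * z.im}) :=
      ((isOpen_lt continuous_const continuous_re).inter
        (isOpen_lt continuous_re continuous_const)).inter
        (isOpen_lt continuous_const (continuous_const.mul continuous_im))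
    refine key _ hUo hUc (fun w hw ↦ ⟨hw.1.1, hw.1.2, fun h ↦ ?_⟩) z₁ hz₁U
      (hUp.eventuallyEq_of_mem (hUpo.mem_nhds hz1Up)) hz
    have := hw.2; rw [h] at this; simp at this
  -- conclusion: case analysis on the position of `s`
  rcases lt_trichotomy s.im 0 with him | him | him
  · exact hUm ⟨⟨hbs, hsa⟩, by show 0 < (-1 : ℝ) * s.im; linarith⟩
  · rcases lt_trichotomy s.re 1 with hre | hre | hre
    · exact hV ⟨⟨hbs, hsa⟩, hre⟩
    · exact absurd (Complex.ext (by simpa using hre) (by simpa using him)) hs1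
    · exact hbase s hbs hsa hre
  · exact hUp ⟨⟨hbs, hsa⟩, by show 0 < (1 : ℝ) * s.im; linarith⟩

/-! ### Müntz's formula for compactly supported Lipschitz data with `∫ F = 0` -/

/-- **Müntz's formula (2.11.1) in the case `∫ F = 0`, compact support.**  Let `A > 0`, `F₀` Lipschitz on
`[0, A]` with `∫_0^A F₀ = 0`, and `F = 1_{(0,A]} F₀` (a jump at `A` is allowed).  Then for every `s ≠ 1`
with `Re s > 0` the Mellin transform of `G(x) = Σ_{n ≥ 1} F(n x)` converges absolutely at `s` and
`∫_0^∞ G(x) x^{s-1} dx = ζ(s) ∫_0^A F₀(x) x^{s-1} dx` (Titchmarsh §2.11: "true by analytic continuation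
for all `σ > 0`"; here `G` is bounded near `0` by the Riemann-sum estimate, and vanishes for `x > A`).
[cite: Titchmarsh1986, §2.11 (2.11.1)] -/
theorem mellin_tsum_indicator_comp_mul_nat {F₀ : ℝ → ℂ} {A : ℝ} {L : ℝ≥0} (hA : 0 < A)
    (hLip : LipschitzOnWith L F₀ (Icc 0 A)) (hint : ∫ t in (0 : ℝ)..A, F₀ t = 0)
    {s : ℂ} (hs : 0 < s.re) (hs1 : s ≠ 1) :
    MellinConvergent (fun x ↦ ∑' n : ℕ, (Ioc 0 A).indicator F₀ (((n + 1 : ℕ) : ℝ) * x)) s ∧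
      mellin (fun x ↦ ∑' n : ℕ, (Ioc 0 A).indicator F₀ (((n + 1 : ℕ) : ℝ) * x)) s =
        riemannZeta s * mellin ((Ioc 0 A).indicator F₀) s := by
  set F : ℝ → ℂ := (Ioc 0 A).indicator F₀ with hF_def
  obtain ⟨M, hM⟩ : ∃ M, ∀ t ∈ Icc 0 A, ‖F₀ t‖ ≤ M :=
    isCompact_Icc.exists_bound_of_continuousOn hLip.continuousOn
  have hM0 : 0 ≤ M := (norm_nonneg _).trans (hM 0 ⟨le_rfl, hA.le⟩)
  have hFle : ∀ t, ‖F t‖ ≤ M := by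
    intro t
    by_cases ht : t ∈ Ioc 0 A
    · rw [hF_def, indicator_of_mem ht]; exact hM t ⟨ht.1.le, ht.2⟩
    · rw [hF_def, indicator_of_notMem ht, norm_zero]; exact hM0
  have hFzero : ∀ t, A < t → F t = 0 := fun t ht ↦
    indicator_of_notMem (fun h ↦ absurd h.2 (not_le.mpr ht)) _
  have hF_integrable : Integrable F :=
    ((hLip.continuousOn.integrableOn_compact isCompact_Icc).mono_set
      Ioc_subset_Icc_self).integrable_indicator measurableSet_Ioc
  have hF_int : LocallyIntegrableOn F (Ioi 0) :=
    hF_integrable.locallyIntegrable.locallyIntegrableOn _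
  have hF_top : ∀ c : ℝ, F =O[atTop] (· ^ (-c)) := fun c ↦ by
    refine (isBigO_zero (fun x : ℝ ↦ x ^ (-c)) atTop).congr' ?_ EventuallyEq.rfl
    filter_upwards [eventually_gt_atTop A] with t ht using (hFzero t ht).symm
  have hF_bot : F =O[𝓝[>] 0] (· ^ (-(0 : ℝ))) := by
    refine IsBigO.of_bound M (Eventually.of_forall fun t ↦ ?_)
    simpa only [neg_zero, Real.rpow_zero, norm_one, mul_one] using hFle t
  -- the summatory function
  set G : ℝ → ℂ := fun x ↦ ∑' n : ℕ, F (((n + 1 : ℕ) : ℝ) * x) with hG_def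
  have hGzero : ∀ x, A < x → G x = 0 := by
    intro x hx
    have h0 : ∀ n : ℕ, F (((n + 1 : ℕ) : ℝ) * x) = 0 := fun n ↦ hFzero _ (by
      have h1 : (1 : ℝ) ≤ ((n + 1 : ℕ) : ℝ) := by exact_mod_cast Nat.le_add_left 1 n
      nlinarith)
    simp only [hG_def, h0, tsum_zero]
  have hG_int : LocallyIntegrableOn G (Ioi 0) :=
    locallyIntegrableOn_tsum_comp_mul_nat F (s := 2) (by norm_num)
      (mellinConvergent_of_isBigO_rpow hF_int (hF_top 3) (by norm_num) hF_bot (by norm_num))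
  have hG_top : G =O[atTop] (· ^ (-(s.re + 1))) := by
    refine (isBigO_zero (fun x : ℝ ↦ x ^ (-(s.re + 1))) atTop).congr' ?_ EventuallyEq.rfl
    filter_upwards [eventually_gt_atTop A] with t ht using (hGzero t ht).symm
  have hG_bot : G =O[𝓝[>] 0] (· ^ (-(0 : ℝ))) := by
    refine IsBigO.of_bound (L * A + M) ?_
    filter_upwards [self_mem_nhdsWithin] with t ht
    simpa only [neg_zero, Real.rpow_zero, norm_one, mul_one] using
      norm_tsum_indicator_comp_mul_nat_le hA hLip hM hint ht
  have hsa : s.re < s.re + 1 := by linarith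
  exact ⟨mellinConvergent_of_isBigO_rpow hG_int hG_top hsa hG_bot hs,
    mellin_tsum_comp_mul_nat_of_isBigO (by linarith) hF_int (hF_top _) hF_bot hG_int hG_top hG_bot
      hs hsa hs1⟩

/-! ### Connes' `𝓔` on the open strip -/

/-- **`𝓔` intertwines Mellin with `ζ(½ + s)` on `Re s > −½`, `s ≠ ½`** — the continuation of
`mellin_connesE` across the critical line for functions with vanishing integral (Connes 2026, Letter §6.2
Fact 6.2 and §6.4: `h`, `h_λ` are the linear combinations "with vanishing integral"; Connes–Consani–Moscovici
2025, (7.1)–(7.4) and Lemma 7.3; Müntz, Titchmarsh §2.11 (2.11.1)): if `f` is Lipschitz on `[0, A]`,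
vanishes on `(A, ∞)` and `∫_0^A f = 0`, then
for `Re s > −½`, `s ≠ ½`, the Mellin transform of `𝓔(f)(u) = u^{1/2} Σ_{n ≥ 1} f(n u)` converges
absolutely at `s` and equals `ζ(½ + s) ∫_0^∞ f(x) x^{s-1/2} dx`.  In particular this holds on the whole
open critical strip `|Re s| < ½` except at the pole `s = ½` of `ζ(½ + s)`; it applies to Connes'
`h_λ = h_{0,λ} + √5 h_{4,λ}` on `(0, λ]` once `∫_0^λ h_λ = 0` is known (evenness + Letter (6.4)).
[cite: Connes2026Letter, §6.2] -/
theorem mellin_connesE_of_integral_eq_zero {f : ℝ → ℝ} {A : ℝ} {L : ℝ≥0} (hA : 0 < A)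
    (hLip : LipschitzOnWith L f (Icc 0 A)) (hsupp : ∀ x, A < x → f x = 0)
    (hint : ∫ t in (0 : ℝ)..A, f t = 0) {s : ℂ} (hs : -(1 / 2 : ℝ) < s.re) (hs1 : s ≠ 1 / 2) :
    MellinConvergent (fun u ↦ (connesE f u : ℂ)) s ∧
      mellin (fun u ↦ (connesE f u : ℂ)) s =
        riemannZeta (s + 1 / 2) * mellin (fun x ↦ (f x : ℂ)) (s + 1 / 2) := by
  set F₀ : ℝ → ℂ := fun t ↦ (f t : ℂ) with hF₀
  have hLip' : LipschitzOnWith (1 * L) F₀ (Icc 0 A) :=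
    Complex.isometry_ofReal.lipschitz.comp_lipschitzOnWith hLip
  have hint' : ∫ t in (0 : ℝ)..A, F₀ t = 0 := by
    simp only [hF₀, intervalIntegral.integral_ofReal, hint, Complex.ofReal_zero]
  have hs' : 0 < (s + 1 / 2).re := by
    simp only [add_re, one_div]
    norm_num
    linarith
  have hs1' : s + 1 / 2 ≠ 1 := by
    intro h; apply hs1; linear_combination h
  obtain ⟨hconv, heq⟩ := mellin_tsum_indicator_comp_mul_nat hA hLip' hint' hs' hs1'
  have hFeq : EqOn (fun x ↦ (f x : ℂ)) ((Ioc 0 A).indicator F₀) (Ioi 0) := by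
    intro x hx
    by_cases hxA : x ≤ A
    · have hmem : x ∈ Ioc 0 A := ⟨hx, hxA⟩
      exact (indicator_of_mem hmem F₀).symm
    · have hx0 : f x = 0 := hsupp x (not_le.mp hxA)
      rw [indicator_of_notMem (fun h ↦ hxA h.2)]
      simp [hx0]
  have hGeq : ∀ u : ℝ, 0 < u → ∑' n : ℕ, ((f (((n + 1 : ℕ) : ℝ) * u) : ℝ) : ℂ)
      = ∑' n : ℕ, (Ioc 0 A).indicator F₀ (((n + 1 : ℕ) : ℝ) * u) := fun u hu ↦
    tsum_congr fun n ↦ hFeq (show (0 : ℝ) < ((n + 1 : ℕ) : ℝ) * u by positivity)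
  have hEq : EqOn (fun u : ℝ ↦ (connesE f u : ℂ))
      (fun u ↦ (u : ℂ) ^ ((1 / 2 : ℂ)) • ∑' n : ℕ, (Ioc 0 A).indicator F₀ (((n + 1 : ℕ) : ℝ) * u))
      (Ioi 0) := fun u hu ↦ by
    show (connesE f u : ℂ) = _
    rw [connesE_ofReal_eq hu, hGeq u hu]
  refine ⟨?_, ?_⟩
  · have h1 : MellinConvergent (fun u : ℝ ↦ (u : ℂ) ^ ((1 / 2 : ℂ)) •
        ∑' n : ℕ, (Ioc 0 A).indicator F₀ (((n + 1 : ℕ) : ℝ) * u)) s :=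
      MellinConvergent.cpow_smul.mpr hconv
    rw [MellinConvergent] at h1 ⊢
    refine (integrableOn_congr_fun ?_ measurableSet_Ioi).mpr h1
    intro u hu
    simp only [hEq hu]
  · have hmF : mellin (fun x ↦ (f x : ℂ)) (s + 1 / 2) = mellin ((Ioc 0 A).indicator F₀) (s + 1 / 2) :=
      setIntegral_congr_fun measurableSet_Ioi fun u hu ↦ by simp only [hFeq hu]
    rw [hmF, ← heq, ← mellin_cpow_smul]
    exact setIntegral_congr_fun measurableSet_Ioi fun u hu ↦ by simp only [hEq hu]

/-! ### Application to the prolate guess `h_λ` -/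

/-- A `C¹` function on a compact interval is Lipschitz there (mean value inequality with the maximum of
`|f'|`). [folklore] -/
theorem exists_lipschitzOnWith_of_contDiffOn_Icc {f : ℝ → ℝ} {a b : ℝ} (hab : a < b)
    {n : WithTop ℕ∞} (hf : ContDiffOn ℝ n f (Icc a b)) (hn : 1 ≤ n) :
    ∃ L : ℝ≥0, LipschitzOnWith L f (Icc a b) := by
  have hcont : ContinuousOn (derivWithin f (Icc a b)) (Icc a b) :=
    hf.continuousOn_derivWithin (uniqueDiffOn_Icc hab) hn
  obtain ⟨C, hC⟩ := isCompact_Icc.exists_bound_of_continuousOn hcont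
  refine ⟨⟨max C 0, le_max_right _ _⟩, ?_⟩
  refine (convex_Icc a b).lipschitzOnWith_of_nnnorm_derivWithin_le
    (hf.differentiableOn (zero_lt_one.trans_le hn).ne') ?_
  intro x hx
  rw [← NNReal.coe_le_coe, coe_nnnorm]
  exact (hC x hx).trans (le_max_left _ _)

/-- **Lemma M for the prolate guess.**  For prolate functions `f0 = h_{0,λ}`, `f4 = h_{4,λ}`
(`IsProlateFunction`) and Connes' `h_λ = prolateGuessH λ f0 f4`, *if* `∫_0^λ h_λ = 0` (which is Letter
§6.4 "the linear combination with vanishing integral" together with the evenness of `h_{0,λ}, h_{4,λ}`;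
evenness is not a field of `IsProlateFunction`, so the half-line integral is kept as a hypothesis), then
for `Re s > −½`, `s ≠ ½`: `∫_0^∞ 𝓔(h_λ)(u) u^{s-1} du = ζ(½ + s) ∫_0^λ h_λ(x) x^{s-1/2} dx`, with absolute
convergence on the left.  This is the exact identity ("Lemma M" of the Fact-6.4 analysis) for the
untruncated `𝓔(h_λ)` (CCM25, proof of Lemma 7.3, works with `𝓜(k_λ)(s)` on `|Re s| < ½`); the tree's
`prolateGuessMellin` truncates the `u`-integral to `[λ^{-1}, λ]`.
[cite: ConnesConsaniMoscovici2025, §7 Lemma 7.3] -/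
theorem mellin_connesE_prolateGuessH {lam : ℝ} {f0 f4 : ℝ → ℝ} (h0 : IsProlateFunction lam 0 f0)
    (h4 : IsProlateFunction lam 4 f4) (hint : ∫ t in (0 : ℝ)..lam, prolateGuessH lam f0 f4 t = 0)
    {s : ℂ} (hs : -(1 / 2 : ℝ) < s.re) (hs1 : s ≠ 1 / 2) :
    MellinConvergent (fun u ↦ (connesE (prolateGuessH lam f0 f4) u : ℂ)) s ∧
      mellin (fun u ↦ (connesE (prolateGuessH lam f0 f4) u : ℂ)) s =
        riemannZeta (s + 1 / 2) * mellin (fun x ↦ (prolateGuessH lam f0 f4 x : ℂ)) (s + 1 / 2) := by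
  have hlam : 0 < lam := h0.lam_pos
  have hdef : prolateGuessH lam f0 f4 = fun x ↦ (Real.sqrt 3 / (2 : ℝ) ^ ((11 : ℝ) / 4)) *
      (f4 x - ((∫ y in (-lam)..lam, f4 y) / (∫ y in (-lam)..lam, f0 y)) * f0 x) := rfl
  have hcd : ContDiffOn ℝ 2 (prolateGuessH lam f0 f4) (Icc (-lam) lam) := by
    rw [hdef]
    exact contDiffOn_const.mul (h4.contDiffOn.sub (contDiffOn_const.mul h0.contDiffOn))
  obtain ⟨L, hL⟩ := exists_lipschitzOnWith_of_contDiffOn_Icc (by linarith) hcd (by norm_num)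
  have hL' : LipschitzOnWith L (prolateGuessH lam f0 f4) (Icc 0 lam) :=
    hL.mono (Icc_subset_Icc (by linarith) le_rfl)
  have hsupp : ∀ x, lam < x → prolateGuessH lam f0 f4 x = 0 := by
    intro x hx
    have hx' : lam < |x| := by rwa [abs_of_pos (hlam.trans hx)]
    simp [hdef, h0.support x hx', h4.support x hx']
  exact mellin_connesE_of_integral_eq_zero hlam hL' hsupp hint hs hs1

end Literature.NumberTheory.LFunctions
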